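import Mathlib
import Literature.NumberTheory.LFunctions.Zhang2022.TypedSection17
import Literature.NumberTheory.LFunctions.Zhang2022.SmoothWeightDiagonal
import Literature.NumberTheory.LFunctions.Zhang2022.PrimitiveCharOrthogonality
import Literature.NumberTheory.LFunctions.Zhang2022.Section17Eval1710
import Literature.NumberTheory.LFunctions.Zhang2022.Section4Lemma45Edge
import HarnessLib

/-!
# Zhang (2022) §17 (17.3), preparation: the u005 term is the term-by-term term, divisor-type sizes
# under `|ν*(n)| ≤ Cn^{1/4}`, `poly(D) = o(P)`, and the off-diagonal bound at a fixed modulus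

Topic `Literature/NumberTheory/LFunctions/Zhang2022` (Landau–Siegel audit tree; verdict-neutral).
Y. Zhang, *Discrete mean estimates and the Landau–Siegel zero*, arXiv:2211.02515v1 (2022)
[Zhang2022LandauSiegel] — **an unrefereed manuscript under adjudication**; nothing here asserts or
denies any of its claims. §17 p. 96 (tex L4723–L4728; DAG `Z22:§17.u005`, `Z22:(17.3)` of the cell
siegel-zhang):

> [u005] `Φ₃⁺(p) = Σ_m Σ_{n<D⁴} (ν*(m)ν(n)/n)(n/m)^{s₀}(Σ*_{ψ (mod p)}ψ(m)ψ̄(n))exp{−𝓛₂²log²(n/m)}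
> + O(ε)`. By trivial estimation, the contribution from the terms with `m ≠ n` above is `o(p)`.

This file supplies the fixed-modulus ingredients of the kernel edge u005 ⇒ (17.3) (companion file
`Section17Eq173`), under ONE divisor-type hypothesis on the coefficients `ν*` of §17.u004,
`|ν*(n)| ≤ C·n^{1/4}` uniformly (true for the five-fold convolution of `τ₂`-bounded sequences that
`ν*` is, not proved here):

* `term_u005_eq` — the typed general term `Typed.Section17.term_u005` IS the term produced by
  "integrating term by term" (`SmoothWeight.integral_LSeries_mul_sum_mul_omega`, file
  `SmoothWeightMellin`) with `a = ν*`, `b = ν`, weights `X_p(m,n) = Σ*_{ψ (mod p)}ψ(m)ψ̄(n)`;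
* `lseriesSummable_nuStar`, `tsum_norm_term_nuStar_le`, `norm_diagSum_le`, `sum_norm_nu_mul_sqrt_le`
  — `Σ_m|ν*(m)|m^{−3/2} ≤ Cζ(5/4)`, `|Σ_{n<D⁴}ν*(n)ν(n)/n| ≤ CD⁵`, `Σ_{n<D⁴}|ν(n)|√n ≤ D¹²`
  (`|ν(n)| ≤ n` is the tree's `Section4.norm_nu_le_self`);
* `forAllLarge_const_mul_pow_le` — `K·D^k ≤ εP` for large `D` (every polynomial in `D` is `o(P)`,
  `P = e^{𝓛⁹}`); `pow_four_lt_and_log_ge` — `D⁴ < p`, `log(p/D⁴) ≥ 2` for `p ∼ P`, `𝓛 ≥ 2`;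
* `offDiagonal_bound_at` — at a fixed modulus: the off-diagonal part of the u005 double sum is
  summable in `m` and `≤ 4C·(Σ_m m^{−5/4})·D¹⁶`, by the tree's explicit inequality
  `SmoothWeight.norm_offDiagonal_le` (d54) with `X₁ = 1`, `X₂ = p − 1` from primitive-character
  orthogonality mod `p` (`Skeleton.norm_sum_finsetOf_p_char_mul_conj_le`).

WHAT THIS IS NOT: a proof of u005 or of the `ν*`-bound; any claim about Theorems 1–2 of the source
or about Landau–Siegel zeros; nothing here bears on the cell's verdict on (8.24).

## References

* Y. Zhang, arXiv:2211.02515v1 (2022), §17 p. 96, (17.3). [cite: Zhang2022LandauSiegel, §17 (17.3)]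
-/

noncomputable section

open Complex Real ComplexConjugate Finset
open Literature.NumberTheory.LFunctions.Zhang2022.Skeleton
open Literature.NumberTheory.LFunctions.Zhang2022.Typed.Section17

namespace Literature.NumberTheory.LFunctions.Zhang2022.Phi3Eval

/-! ## §1. The u005 term is the term-by-term term -/

section Term

variable (c' : ℝ) {D : ℕ} (χ : DirichletCharacter ℂ D)

/-- `s₀ ≠ 0` (`Re s₀ = 1/2`). [cite: Zhang2022LandauSiegel, §2 (2.8)] -/
theorem s0_ne_zero (D : ℕ) : s0 D ≠ 0 := fun h => by
  have := s0_re D; rw [h] at this; norm_num at this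

/-- **The general term of §17.u005 is `T(m,n)·X_p(m,n)`** with
`T(m,n) = ν*(m)m^{−s₀}·ν(n)n^{s₀−1}·e^{−𝓛₂²log²(n/m)}` (the term of
`SmoothWeight.integral_LSeries_mul_sum_mul_omega`) and `X_p(m,n) = Σ*_{ψ (mod p)}ψ(m)ψ̄(n)`, for
every `m` and every `n ≥ 1` (both sides vanish at `m = 0`). [cite: Zhang2022LandauSiegel, §17 u005 p.96] -/
theorem term_u005_eq (p m n : ℕ) (hn : n ≠ 0) :
    term_u005 c' χ p m n =
      LSeries.term (nuStar c' χ) (SmoothWeight.s0 (t0 D)) m *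
          (nu χ n * (n : ℂ) ^ (SmoothWeight.s0 (t0 D) - 1)) *
        cexp (-(ell2 D : ℂ) ^ 2 * (Real.log ((n : ℝ) / m) : ℂ) ^ 2) *
        ∑ x ∈ chrMod D p, x.ψ (m : ZMod x.p) * conj (x.ψ (n : ZMod x.p)) := by
  have hs : SmoothWeight.s0 (t0 D) = s0 D := rfl
  rw [hs]
  rcases Nat.eq_zero_or_pos m with rfl | hm
  · rw [LSeries.term_zero, term_u005]
    simp [Complex.zero_cpow (s0_ne_zero D)]
  · have hm0 : (m : ℂ) ≠ 0 := Nat.cast_ne_zero.mpr hm.ne'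
    have hn0 : (n : ℂ) ≠ 0 := Nat.cast_ne_zero.mpr hn
    have hmr : (0 : ℝ) ≤ m := Nat.cast_nonneg m
    have hnr : (0 : ℝ) ≤ n := Nat.cast_nonneg n
    rw [term_u005, LSeries.term_of_ne_zero hm.ne']
    -- `(n/m)^{s₀} = n^{s₀}·(m^{s₀})⁻¹`
    have hquot : ((((n : ℝ) / m : ℝ)) : ℂ) ^ s0 D = (n : ℂ) ^ s0 D * ((m : ℂ) ^ s0 D)⁻¹ := by
      have h1 : ((((n : ℝ) / m : ℝ)) : ℂ) = ((n : ℝ) : ℂ) * (((m : ℝ)⁻¹ : ℝ) : ℂ) := by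
        push_cast; ring
      rw [h1, Complex.mul_cpow_ofReal_nonneg hnr (inv_nonneg.mpr hmr)]
      push_cast
      rw [Complex.inv_cpow _ _ (by rw [Complex.natCast_arg]; exact Real.pi_ne_zero.symm)]
    -- `n^{s₀−1} = n^{s₀}/n`
    have hpow : (n : ℂ) ^ (s0 D - 1) = (n : ℂ) ^ s0 D / n := by
      rw [Complex.cpow_sub _ _ hn0, Complex.cpow_one]
    -- the Gaussian factor
    have hexp : ((Real.exp (-(ell2 D ^ 2 * Real.log ((n : ℝ) / m) ^ 2)) : ℝ) : ℂ) =
        cexp (-(ell2 D : ℂ) ^ 2 * (Real.log ((n : ℝ) / m) : ℂ) ^ 2) := by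
      push_cast; ring_nf
    have hms : (m : ℂ) ^ s0 D ≠ 0 := fun h => hm0 ((cpow_eq_zero_iff _ _).mp h).1
    rw [hquot, hpow, hexp]
    field_simp

end Term

/-! ## §2. Sizes at a fixed modulus -/

section Sizes

variable {c' : ℝ} {D : ℕ} (χ : DirichletCharacter ℂ D)

/-- Under the `ν*`-bound `|ν*(n)| ≤ Cn^{1/4}`: `ν*` is `L`-summable at `3/2`.
[cite: Zhang2022LandauSiegel, §17 u004 p.96] -/
theorem lseriesSummable_nuStar {C : ℝ} (hC : ∀ n : ℕ, ‖nuStar c' χ n‖ ≤ C * (n : ℝ) ^ (1 / 4 : ℝ)) :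
    LSeriesSummable (nuStar c' χ) (3 / 2 : ℂ) := by
  refine LSeriesSummable_of_le_const_mul_rpow (x := 5 / 4) (by norm_num) ⟨C, fun n _ => ?_⟩
  have := hC n
  norm_num at this ⊢
  exact this

/-- Under the `ν*`-bound: `Σ_m |ν*(m)|m^{−3/2} ≤ C·Σ_m m^{−5/4}` (a constant independent of `D`).
[cite: Zhang2022LandauSiegel, §17 u004 p.96] -/
theorem tsum_norm_term_nuStar_le {C : ℝ} (hC : ∀ n : ℕ, ‖nuStar c' χ n‖ ≤ C * (n : ℝ) ^ (1 / 4 : ℝ)) :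
    ∑' m : ℕ, ‖LSeries.term (nuStar c' χ) (3 / 2 : ℂ) m‖ ≤
      C * ∑' m : ℕ, (m : ℝ) ^ (-(5 / 4 : ℝ)) := by
  have hC0 : 0 ≤ C := by
    have := hC 1; simp at this; exact (norm_nonneg _).trans this
  have hsum : Summable fun m : ℕ => (m : ℝ) ^ (-(5 / 4 : ℝ)) :=
    Real.summable_nat_rpow.mpr (by norm_num)
  rw [← tsum_mul_left]
  refine Summable.tsum_le_tsum (fun m => ?_) (summable_norm_iff.mpr (lseriesSummable_nuStar χ hC))
    (hsum.mul_left C)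
  rcases Nat.eq_zero_or_pos m with rfl | hm
  · simp
  · rw [LSeries.norm_term_eq, if_neg hm.ne']
    have hm' : (0 : ℝ) < m := Nat.cast_pos.mpr hm
    rw [div_le_iff₀ (Real.rpow_pos_of_pos hm' _)]
    calc ‖nuStar c' χ m‖ ≤ C * (m : ℝ) ^ (1 / 4 : ℝ) := hC m
      _ = C * (m : ℝ) ^ (-(5 / 4 : ℝ)) * (m : ℝ) ^ ((3 / 2 : ℂ).re) := by
          rw [mul_assoc, ← Real.rpow_add hm']; norm_num

/-- Under the `ν*`-bound: `|Σ_{n<D⁴} ν*(n)ν(n)/n| ≤ C·D⁵`. [cite: Zhang2022LandauSiegel, §17 (17.3) p.96] -/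
theorem norm_diagSum_le {C : ℝ} (hC : ∀ n : ℕ, ‖nuStar c' χ n‖ ≤ C * (n : ℝ) ^ (1 / 4 : ℝ)) :
    ‖∑ n ∈ Finset.Ico 1 (D ^ 4), nuStar c' χ n * nu χ n / (n : ℂ)‖ ≤ C * (D : ℝ) ^ 5 := by
  have hC0 : 0 ≤ C := by
    have := hC 1; simp at this; exact (norm_nonneg _).trans this
  have hD4 : ((D ^ 4 : ℕ) : ℝ) = (D : ℝ) ^ 4 := by push_cast; ring
  have hterm : ∀ n ∈ Finset.Ico 1 (D ^ 4), ‖nuStar c' χ n * nu χ n / (n : ℂ)‖ ≤ C * (D : ℝ) := by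
    intro n hn
    rw [Finset.mem_Ico] at hn
    have hn0 : (0 : ℝ) < n := by exact_mod_cast hn.1
    have hnD : (n : ℝ) ≤ (D : ℝ) ^ 4 := by rw [← hD4]; exact_mod_cast hn.2.le
    rw [norm_div, norm_mul, Complex.norm_natCast, div_le_iff₀ hn0]
    have h14 : (n : ℝ) ^ (1 / 4 : ℝ) ≤ D := by
      calc (n : ℝ) ^ (1 / 4 : ℝ) ≤ ((D : ℝ) ^ 4) ^ (1 / 4 : ℝ) :=
            Real.rpow_le_rpow hn0.le hnD (by norm_num)
        _ = D := by
            rw [← Real.rpow_natCast, ← Real.rpow_mul (Nat.cast_nonneg D)]; norm_num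
    calc ‖nuStar c' χ n‖ * ‖nu χ n‖ ≤ C * (n : ℝ) ^ (1 / 4 : ℝ) * n :=
          mul_le_mul (hC n) (Section4.norm_nu_le_self χ n) (norm_nonneg _) (by positivity)
      _ ≤ C * D * n := by gcongr
  calc ‖∑ n ∈ Finset.Ico 1 (D ^ 4), nuStar c' χ n * nu χ n / (n : ℂ)‖
      ≤ ∑ n ∈ Finset.Ico 1 (D ^ 4), C * (D : ℝ) := (norm_sum_le _ _).trans (Finset.sum_le_sum hterm)
    _ = ((D ^ 4 - 1 : ℕ) : ℝ) * (C * D) := by rw [Finset.sum_const, Nat.card_Ico, nsmul_eq_mul]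
    _ ≤ (D : ℝ) ^ 4 * (C * D) := by
        gcongr
        rw [← hD4]; exact_mod_cast Nat.sub_le _ _
    _ = C * (D : ℝ) ^ 5 := by ring

/-- `Σ_{n<D⁴} |ν(n)|√n ≤ D¹²` (crude: `|ν(n)| ≤ n ≤ D⁴`, `√n ≤ n ≤ D⁴`, at most `D⁴` terms).
[cite: Zhang2022LandauSiegel, §17 (17.3) p.96] -/
theorem sum_norm_nu_mul_sqrt_le :
    ∑ n ∈ Finset.Ico 1 (D ^ 4), ‖nu χ n‖ * Real.sqrt n ≤ (D : ℝ) ^ 12 := by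
  have hD4 : ((D ^ 4 : ℕ) : ℝ) = (D : ℝ) ^ 4 := by push_cast; ring
  have hterm : ∀ n ∈ Finset.Ico 1 (D ^ 4), ‖nu χ n‖ * Real.sqrt n ≤ (D : ℝ) ^ 4 * (D : ℝ) ^ 4 := by
    intro n hn
    rw [Finset.mem_Ico] at hn
    have hn1 : (1 : ℝ) ≤ n := by exact_mod_cast hn.1
    have hnD : (n : ℝ) ≤ (D : ℝ) ^ 4 := by rw [← hD4]; exact_mod_cast hn.2.le
    have hsq : Real.sqrt n ≤ n := by
      rw [Real.sqrt_le_left (by linarith)]; nlinarith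
    exact mul_le_mul ((Section4.norm_nu_le_self χ n).trans hnD) (hsq.trans hnD) (Real.sqrt_nonneg _)
      (by positivity)
  calc ∑ n ∈ Finset.Ico 1 (D ^ 4), ‖nu χ n‖ * Real.sqrt n
      ≤ ∑ n ∈ Finset.Ico 1 (D ^ 4), (D : ℝ) ^ 4 * (D : ℝ) ^ 4 := Finset.sum_le_sum hterm
    _ = ((D ^ 4 - 1 : ℕ) : ℝ) * ((D : ℝ) ^ 4 * (D : ℝ) ^ 4) := by
        rw [Finset.sum_const, Nat.card_Ico, nsmul_eq_mul]
    _ ≤ (D : ℝ) ^ 4 * ((D : ℝ) ^ 4 * (D : ℝ) ^ 4) := by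
        gcongr
        rw [← hD4]; exact_mod_cast Nat.sub_le _ _
    _ = (D : ℝ) ^ 12 := by ring

end Sizes

/-! ## §3. Eventual comparisons `poly(D) = o(p)` -/

section Eventual

/-- **`K·D^k ≤ ε·P` for all large `D`** (`P = e^{𝓛⁹}`, `D^k = e^{k𝓛}`): every polynomial in `D` is
`o(P)`, hence `o(p)` for `p ∼ P`. [cite: Zhang2022LandauSiegel, §2 (2.6)] -/
theorem forAllLarge_const_mul_pow_le (K : ℝ) {ε : ℝ} (hε : 0 < ε) (k : ℕ) :
    ForAllLarge fun D _ _ => K * (D : ℝ) ^ k ≤ ε * bigP D := by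
  obtain ⟨D₀, h0⟩ := exists_nat_forall_le_ell (max ((k : ℝ) + 1) (|K| / ε))
  refine ⟨D₀, fun D _ χ hD _ _ => ?_⟩
  have hℓ := h0 D hD
  have hℓk : (k : ℝ) + 1 ≤ ell D := le_trans (le_max_left _ _) hℓ
  have hℓK : |K| / ε ≤ ell D := le_trans (le_max_right _ _) hℓ
  have hℓ1 : 1 ≤ ell D := by linarith [(Nat.cast_nonneg k : (0 : ℝ) ≤ k)]
  have hDpos : (0 : ℝ) < D := by exact_mod_cast Nat.pos_of_ne_zero (NeZero.ne D)
  have hDk : (D : ℝ) ^ k = Real.exp (k * ell D) := by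
    rw [ell, ← Real.exp_log hDpos, ← Real.exp_nat_mul, Real.log_exp]
  -- `k𝓛 + 𝓛 ≤ 𝓛⁹`
  have h9 : (k : ℝ) * ell D + ell D ≤ ell D ^ 9 := by
    have h2 : ((k : ℝ) + 1) * ell D ≤ ell D * ell D := mul_le_mul_of_nonneg_right hℓk (by linarith)
    have h3 : ell D * ell D ≤ ell D ^ 9 := by
      calc ell D * ell D = ell D ^ 2 := (sq _).symm
        _ ≤ ell D ^ 9 := pow_le_pow_right₀ hℓ1 (by norm_num)
    linarith
  -- `|K| ≤ ε·e^{𝓛}`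
  have hK : |K| ≤ ε * Real.exp (ell D) := by
    have h1 : |K| ≤ ε * ell D := by rw [div_le_iff₀ hε] at hℓK; linarith
    exact h1.trans (mul_le_mul_of_nonneg_left ((Real.add_one_le_exp _).trans' (by linarith)) hε.le)
  calc K * (D : ℝ) ^ k ≤ |K| * (D : ℝ) ^ k :=
        mul_le_mul_of_nonneg_right (le_abs_self K) (by positivity)
    _ ≤ ε * Real.exp (ell D) * Real.exp (k * ell D) := by
        rw [hDk]; exact mul_le_mul_of_nonneg_right hK (Real.exp_nonneg _)
    _ = ε * Real.exp (k * ell D + ell D) := by rw [mul_assoc, ← Real.exp_add]; ring_nf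
    _ ≤ ε * bigP D := by
        rw [bigP]; exact mul_le_mul_of_nonneg_left (Real.exp_le_exp.mpr h9) hε.le

/-- `D⁴ < p` for `p ∼ P` once `𝓛 ≥ 2` (`D⁴ = e^{4𝓛} ≤ e^{𝓛⁹} = P < p`), and then
`log(p/D⁴) ≥ 𝓛⁹ − 4𝓛 ≥ 2`. [cite: Zhang2022LandauSiegel, §2 (2.6)] -/
theorem pow_four_lt_and_log_ge {D p : ℕ} [NeZero D] (hℓ : 2 ≤ ell D) (hp : p ∈ primeWindow D) :
    (D : ℝ) ^ 4 < p ∧ 2 ≤ Real.log ((p : ℝ) / (D : ℝ) ^ 4) := by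
  have hDpos : (0 : ℝ) < D := by exact_mod_cast Nat.pos_of_ne_zero (NeZero.ne D)
  have hD4 : (D : ℝ) ^ 4 = Real.exp (4 * ell D) := by
    rw [ell, ← Real.exp_log hDpos, ← Real.exp_nat_mul, Real.log_exp]; norm_num
  have h49 : 4 * ell D + 2 ≤ ell D ^ 9 := by
    have h8 : (2 : ℝ) ^ 8 ≤ ell D ^ 8 := pow_le_pow_left₀ (by norm_num) hℓ 8
    have h9 : ell D ^ 9 = ell D ^ 8 * ell D := by ring
    nlinarith
  have hP : bigP D < p := bigP_lt_of_mem_primeWindow hp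
  have hlogp : ell D ^ 9 < Real.log p := by
    have := Real.log_lt_log (bigP_pos D) hP; rwa [log_bigP] at this
  have hp0 : (0 : ℝ) < p := pos_of_mem_primeWindow hp
  constructor
  · calc (D : ℝ) ^ 4 = Real.exp (4 * ell D) := hD4
      _ ≤ Real.exp (ell D ^ 9) := Real.exp_le_exp.mpr (by linarith)
      _ = bigP D := rfl
      _ < p := hP
  · rw [Real.log_div hp0.ne' (by positivity), hD4, Real.log_exp]
    linarith

end Eventual

/-! ## §4. The off-diagonal claim and (17.3) from u005 and the `ν*`-bound -/

section Main

variable {c' : ℝ}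

/-- **The off-diagonal estimate at a fixed modulus**: for `𝓛 ≥ 2`, `p ∼ P` and
`|ν*(n)| ≤ Cn^{1/4}`, the off-diagonal part of the u005 double sum is summable in `m` and bounded by
`4C·(Σ_m m^{−5/4})·D¹⁶` (tree: `SmoothWeight.norm_offDiagonal_le` with `X₁ = 1`, `X₂ = p − 1` from
primitive-character orthogogonality, `Σ_{n<D⁴}|ν(n)|√n ≤ D¹²`, `e^{1/(4𝓛₂²)} ≤ 3`,
`(p−1)e^{−u₀(𝓛₂²u₀−1)} ≤ D⁴`). [cite: Zhang2022LandauSiegel, §17 (17.3) p.96] -/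
theorem offDiagonal_bound_at {D : ℕ} [NeZero D] (χ : DirichletCharacter ℂ D) (hℓ : 2 ≤ ell D)
    {p : ℕ} (hp : p ∈ primeWindow D) {C : ℝ}
    (hC : ∀ n : ℕ, ‖nuStar c' χ n‖ ≤ C * (n : ℝ) ^ (1 / 4 : ℝ)) :
    Summable (fun m : ℕ => ∑ n ∈ (Finset.Ico 1 (D ^ 4)).filter (fun n => n ≠ m),
        term_u005 c' χ p m n) ∧
    ‖∑' m : ℕ, ∑ n ∈ (Finset.Ico 1 (D ^ 4)).filter (fun n => n ≠ m), term_u005 c' χ p m n‖ ≤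
      4 * C * (∑' m : ℕ, (m : ℝ) ^ (-(5 / 4 : ℝ))) * (D : ℝ) ^ 16 := by
  have hC0 : 0 ≤ C := by
    have := hC 1; simp at this; exact (norm_nonneg _).trans this
  set Z : ℝ := ∑' m : ℕ, (m : ℝ) ^ (-(5 / 4 : ℝ)) with hZ
  have hZ0 : 0 ≤ Z := tsum_nonneg fun m => by positivity
  have hℓ0 : 0 < ell D := by linarith
  have hL2 : 0 < ell2 D := by rw [ell2]; positivity
  have hL2' : 1 ≤ ell2 D ^ 2 := by
    rw [ell2]; exact one_le_pow₀ (one_le_pow₀ (by linarith))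
  obtain ⟨hD4p, hu2⟩ := pow_four_lt_and_log_ge hℓ hp
  have hD4nat : D ^ 4 < p := by exact_mod_cast (show ((D ^ 4 : ℕ) : ℝ) < p by push_cast; exact hD4p)
  have hp0 : (0 : ℝ) < p := pos_of_mem_primeWindow hp
  have hDpos : (0 : ℝ) < D := by exact_mod_cast Nat.pos_of_ne_zero (NeZero.ne D)
  -- the weights `X_p(m,n)`
  set X : ℕ → ℕ → ℂ := fun m n => ∑ x ∈ chrMod D p, x.ψ (m : ZMod x.p) * conj (x.ψ (n : ZMod x.p))
    with hX
  have hS : ∀ n ∈ Finset.Ico 1 (D ^ 4), n ≠ 0 ∧ n ≤ D ^ 4 := fun n hn => by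
    rw [Finset.mem_Ico] at hn; exact ⟨by omega, hn.2.le⟩
  have hu₀ : 1 ≤ ell2 D ^ 2 * Real.log ((p : ℝ) / ((D ^ 4 : ℕ) : ℝ)) := by
    have : (((D ^ 4 : ℕ) : ℝ)) = (D : ℝ) ^ 4 := by push_cast; ring
    rw [this]; nlinarith
  have hX1 : ∀ m n, n ∈ Finset.Ico 1 (D ^ 4) → m ≠ n → m < p → ‖X m n‖ ≤ 1 := by
    intro m n hn hmn hm
    have hn' : n < p := lt_of_lt_of_le (Finset.mem_Ico.mp hn).2 hD4nat.le
    have hne : (m : ZMod p) ≠ (n : ZMod p) := fun h =>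
      hmn ((PrimChar.natCast_eq_natCast_iff_of_lt hm hn').mp h)
    exact (norm_sum_finsetOf_p_char_mul_conj_le hp m n).2 hne
  have hX2 : ∀ m n, n ∈ Finset.Ico 1 (D ^ 4) → p ≤ m → ‖X m n‖ ≤ (p : ℝ) - 1 := fun m n _ _ =>
    (norm_sum_finsetOf_p_char_mul_conj_le hp m n).1
  have hp1 : (0 : ℝ) ≤ (p : ℝ) - 1 := by
    have : (1 : ℝ) ≤ p := by exact_mod_cast (prime_of_mem_primeWindow' hp).one_lt.le
    linarith
  have key := SmoothWeight.norm_offDiagonal_le hL2 (t0 D) (lseriesSummable_nuStar χ hC) (nu χ) hS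
    hD4nat hu₀ X zero_le_one hp1 hX1 hX2
  -- rewrite the tree's terms as the typed `term_u005`
  have hterm : ∀ m : ℕ, ∑ n ∈ (Finset.Ico 1 (D ^ 4)).filter (fun n => n ≠ m), term_u005 c' χ p m n =
      ∑ n ∈ (Finset.Ico 1 (D ^ 4)).filter (fun n => n ≠ m),
        LSeries.term (nuStar c' χ) (SmoothWeight.s0 (t0 D)) m *
            (nu χ n * (n : ℂ) ^ (SmoothWeight.s0 (t0 D) - 1)) *
          cexp (-(ell2 D : ℂ) ^ 2 * (Real.log ((n : ℝ) / m) : ℂ) ^ 2) * X m n := by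
    intro m
    refine Finset.sum_congr rfl fun n hn => ?_
    have hn0 : n ≠ 0 := (hS n (Finset.mem_filter.mp hn).1).1
    rw [hX]; exact term_u005_eq c' χ p m n hn0
  have hfun : (fun m : ℕ => ∑ n ∈ (Finset.Ico 1 (D ^ 4)).filter (fun n => n ≠ m),
      term_u005 c' χ p m n) = fun m => ∑ n ∈ (Finset.Ico 1 (D ^ 4)).filter (fun n => n ≠ m),
        LSeries.term (nuStar c' χ) (SmoothWeight.s0 (t0 D)) m *
            (nu χ n * (n : ℂ) ^ (SmoothWeight.s0 (t0 D) - 1)) *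
          cexp (-(ell2 D : ℂ) ^ 2 * (Real.log ((n : ℝ) / m) : ℂ) ^ 2) * X m n := funext hterm
  rw [hfun]
  refine ⟨key.1, key.2.trans ?_⟩
  -- sizes of the three factors
  have hA := tsum_norm_term_nuStar_le χ hC
  have hB := sum_norm_nu_mul_sqrt_le (D := D) χ
  have hexp1 : Real.exp (1 / (4 * ell2 D ^ 2)) ≤ 3 := by
    have h1 : 1 / (4 * ell2 D ^ 2) ≤ 1 := by
      rw [div_le_one (by positivity)]; nlinarith
    calc Real.exp (1 / (4 * ell2 D ^ 2)) ≤ Real.exp 1 := Real.exp_le_exp.mpr h1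
      _ ≤ 3 := le_of_lt (lt_trans Real.exp_one_lt_d9 (by norm_num))
  have hD4eq : (((D ^ 4 : ℕ) : ℝ)) = (D : ℝ) ^ 4 := by push_cast; ring
  have hexp2 : ((p : ℝ) - 1) *
      Real.exp (-(Real.log ((p : ℝ) / ((D ^ 4 : ℕ) : ℝ)) *
        (ell2 D ^ 2 * Real.log ((p : ℝ) / ((D ^ 4 : ℕ) : ℝ)) - 1))) ≤ (D : ℝ) ^ 4 := by
    rw [hD4eq]
    set u : ℝ := Real.log ((p : ℝ) / (D : ℝ) ^ 4) with hu
    have hu0 : 0 ≤ u := by linarith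
    have h1 : 1 ≤ ell2 D ^ 2 * u - 1 := by nlinarith
    have h2 : Real.exp (-(u * (ell2 D ^ 2 * u - 1))) ≤ Real.exp (-u) :=
      Real.exp_le_exp.mpr (by nlinarith)
    have h3 : Real.exp (-u) = (D : ℝ) ^ 4 / p := by
      rw [hu, Real.exp_neg, Real.exp_log (div_pos hp0 (pow_pos hDpos 4)), inv_div]
    calc ((p : ℝ) - 1) * Real.exp (-(u * (ell2 D ^ 2 * u - 1)))
        ≤ ((p : ℝ) - 1) * Real.exp (-u) := mul_le_mul_of_nonneg_left h2 hp1
      _ = ((p : ℝ) - 1) / p * (D : ℝ) ^ 4 := by rw [h3]; ring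
      _ ≤ 1 * (D : ℝ) ^ 4 := by
          refine mul_le_mul_of_nonneg_right ?_ (by positivity)
          rw [div_le_one hp0]; linarith
      _ = (D : ℝ) ^ 4 := one_mul _
  have hD1 : (1 : ℝ) ≤ D := by exact_mod_cast Nat.pos_of_ne_zero (NeZero.ne D)
  have hfac : 1 * Real.exp (1 / (4 * ell2 D ^ 2)) + ((p : ℝ) - 1) *
      Real.exp (-(Real.log ((p : ℝ) / ((D ^ 4 : ℕ) : ℝ)) *
        (ell2 D ^ 2 * Real.log ((p : ℝ) / ((D ^ 4 : ℕ) : ℝ)) - 1))) ≤ 4 * (D : ℝ) ^ 4 := by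
    have : (3 : ℝ) ≤ 3 * (D : ℝ) ^ 4 := by nlinarith [one_le_pow₀ (n := 4) hD1]
    linarith
  calc (∑' m : ℕ, ‖LSeries.term (nuStar c' χ) (3 / 2 : ℂ) m‖) *
        (∑ n ∈ Finset.Ico 1 (D ^ 4), ‖nu χ n‖ * Real.sqrt n) *
        (1 * Real.exp (1 / (4 * ell2 D ^ 2)) + ((p : ℝ) - 1) *
          Real.exp (-(Real.log ((p : ℝ) / ((D ^ 4 : ℕ) : ℝ)) *
            (ell2 D ^ 2 * Real.log ((p : ℝ) / ((D ^ 4 : ℕ) : ℝ)) - 1))))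
      ≤ (C * Z) * (D : ℝ) ^ 12 * (4 * (D : ℝ) ^ 4) := by
        refine mul_le_mul (mul_le_mul hA hB (Finset.sum_nonneg fun n _ => by positivity)
          (by positivity)) hfac (by positivity) (by positivity)
    _ = 4 * C * Z * (D : ℝ) ^ 16 := by ring

end Main

end Literature.NumberTheory.LFunctions.Zhang2022.Phi3Eval
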